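import Summits.QuantumFields.YangMills.Theorems.LuscherReductionTwistedTraceScalingFPWeightCore
import Summits.QuantumFields.YangMills.Theorems.LuscherReductionTwistedTraceScalingRecordBricks
import HarnessLib

/-!
# (P) FOR THE RECORD WEIGHT AT ANY WINDOW CONSTANT `K ≥ 1`: the Faddeev–Popov normaliser `gaugeAvg (recordChi L s K M β)` is constant on the fat tube to relative `O((Kβ^{-s})²)`
# (route `FlatTubeReduction`, crux K1 `NearFlatRatioLaw` stmt-QuantumFields-24720; seat `ym-line-ftr-p1` g17; rate twin «ratepack-v6», stubs `stub_hST_A` (K-port) and `stub_hODpot_A`;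
# R2b1 RECORD rung — no summit statement is proved here)

WHY (crux workfile `Lines/ratepack-v6-port-g17.md` §2, §6).  Lane A instantiates `…FPWeightCore.fpWeight_core_constant` at the window constant `K = 43` inline (e.g.
`…BODefectCoreRecord`, `…BOStiffCoreCoeff`); the rate twin's weight is `recordChi L (1/6) (42D+1) M` (`D = max 1 (|Site|/7)`), and the hypothesis `hP` of
`…SquaredProfileNumbers.fibre_weighted_sq_mass_le` / `…BOStiffCoreCoeff.softWeight_orthoTube_compare` is exactly this (P) fact.  One instance for every `K ≥ 1`, `0 < s ≤ 1/3`: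
★★ `recordChi_core_constant` — `∃ M₀ ≥ 2, ∀ M ≥ M₀, ∃ C ≥ 0, ∀ᶠ β, (∀ U ∈ fatTube, N̄(1 − C(Kβ^{-s})²) ≤ gaugeAvg χ U ≤ N̄(1 + C(Kβ^{-s})²)) ∧ C(Kβ^{-s})² < 1`; ★ `recordChi_core_upper`
(the upper half in the `(1+κ)` form, `0 ≤ κ < 1`).
HONEST FRAMING: an instance of a landed theorem; femto rung R2b1 (RECORD label); not infinite volume, not a gap, not Clay.  No defs, no named facts, no `sorry`.
-/

set_option autoImplicit false

noncomputable section

open MeasureTheory Filter Topology Real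
open scoped BigOperators
open Literature.MathematicalPhysics.QuantumFieldTheory
open Literature.MathematicalPhysics.QuantumLattice

namespace Summit.QuantumFields.YangMills.Theorems.FemtoTransferGap.TwoLattice.ConstTube

open Summit.QuantumFields.YangMills.Theorems.FemtoTransferGap
open Summit.QuantumFields.YangMills.Theorems.FemtoTransferGap.TwoLattice.Avg

variable {L : ℕ} [NeZero L]

/-- ★★ **(P) FOR `recordChi L s K M`, ANY `K ≥ 1`, `0 < s ≤ 1/3`.**  There is `M₀ ≥ 2` such that for every `M ≥ M₀` there is `C ≥ 0` with, eventually in `β`: for every `U` in the fat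
tube `fatTubeRho L (K·β^{-s}) (M·K·β^{-s}) β`, `N̄(β⁻¹)·(1 − C(Kβ^{-s})²) ≤ gaugeAvg (recordChi L s K M β) U ≤ N̄(β⁻¹)·(1 + C(Kβ^{-s})²)`, and `C(Kβ^{-s})² < 1`. [cite: Luscher1983, §3] -/
theorem recordChi_core_constant (hL : Nonempty (NzSite L)) {s K : ℝ} (hs : 0 < s) (hs3 : s ≤ 1 / 3) (hK : 1 ≤ K) :
    ∃ M₀ : ℝ, 2 ≤ M₀ ∧ ∀ M : ℝ, M₀ ≤ M → ∃ C : ℝ, 0 ≤ C ∧ ∀ᶠ β : ℝ in atTop,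
      (∀ U ∈ fatTubeRho L (fun β => K * powScale s β) (fun b => M * (K * powScale s b)) β,
        fpWeightBar L (powScale 1 β) * (1 - C * (K * powScale s β) ^ 2) ≤ gaugeAvg (recordChi L s K M β) U ∧
          gaugeAvg (recordChi L s K M β) U ≤ fpWeightBar L (powScale 1 β) * (1 + C * (K * powScale s β) ^ 2)) ∧
      C * (K * powScale s β) ^ 2 < 1 := by
  have hK0 : 0 < K := by linarith
  have hδ0 : ∀ β : ℝ, 0 < K * powScale s β := fun β => mul_pos hK0 (powScale_pos _ _)
  have hδt : Tendsto (fun β : ℝ => K * powScale s β) atTop (𝓝 0) := by simpa using (tendsto_powScale hs).const_mul K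
  have hsd : ∀ᶠ β : ℝ in atTop, 0 < powScale 1 β ∧ powScale 1 β ≤ (fun β : ℝ => K * powScale s β) β ^ 3 := by
    filter_upwards [eventually_ge_atTop (1 : ℝ)] with β hβ
    refine ⟨powScale_pos _ _, ?_⟩
    have h1 : powScale 1 β ≤ powScale s β ^ 3 := powScale_one_le_cube hs3 hβ
    have h2 : powScale s β ^ 3 ≤ (K * powScale s β) ^ 3 := pow_le_pow_left₀ (powScale_pos _ _).le (le_mul_of_one_le_left (powScale_pos _ _).le hK) 3
    exact h1.trans h2
  obtain ⟨M₀, hM₀, hPM⟩ := fpWeight_core_constant L hL hδ0 hδt hsd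
  refine ⟨M₀, hM₀, fun M hM => ?_⟩
  obtain ⟨C, β₀, hC, hP⟩ := hPM M hM
  refine ⟨C, hC, ?_⟩
  have eκ : ∀ᶠ β : ℝ in atTop, C * (K * powScale s β) ^ 2 < 1 := by
    have h := (hδt.pow 2).const_mul C
    rw [zero_pow two_ne_zero, mul_zero] at h
    exact h.eventually (eventually_lt_nhds one_pos)
  filter_upwards [eventually_ge_atTop β₀, eκ] with β hβ hκ
  exact ⟨fun U hU => hP β hβ U hU, hκ⟩

/-- ★ **The upper half of (P) in `(1+κ)` form**: eventually there is, for each `β`, the constant `κ_β = C(Kβ^{-s})² ∈ [0,1)` with `gaugeAvg χ ≤ N̄(1+κ_β)` on the fat tube — the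
hypothesis `hP` of `…SquaredProfileNumbers.fibre_weighted_sq_mass_le` and of `…BOStiffCoreCoeff.softWeight_orthoTube_compare` (with the matching lower half). [folklore] -/
theorem recordChi_core_upper (hL : Nonempty (NzSite L)) {s K : ℝ} (hs : 0 < s) (hs3 : s ≤ 1 / 3) (hK : 1 ≤ K) :
    ∃ M₀ : ℝ, 2 ≤ M₀ ∧ ∀ M : ℝ, M₀ ≤ M → ∃ C : ℝ, 0 ≤ C ∧ ∀ᶠ β : ℝ in atTop,
      0 ≤ C * (K * powScale s β) ^ 2 ∧ C * (K * powScale s β) ^ 2 < 1 ∧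
      ∀ U ∈ fatTubeRho L (fun β => K * powScale s β) (fun b => M * (K * powScale s b)) β,
        fpWeightBar L (powScale 1 β) * (1 - C * (K * powScale s β) ^ 2) ≤ gaugeAvg (recordChi L s K M β) U ∧
        gaugeAvg (recordChi L s K M β) U ≤ fpWeightBar L (powScale 1 β) * (1 + C * (K * powScale s β) ^ 2) := by
  obtain ⟨M₀, hM₀, h⟩ := recordChi_core_constant (L := L) hL hs hs3 hK
  refine ⟨M₀, hM₀, fun M hM => ?_⟩
  obtain ⟨C, hC, hev⟩ := h M hM
  refine ⟨C, hC, ?_⟩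
  filter_upwards [hev] with β hβ
  exact ⟨by positivity, hβ.2, hβ.1⟩

end Summit.QuantumFields.YangMills.Theorems.FemtoTransferGap.TwoLattice.ConstTube

end
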